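import Summits.HodgeConjecture.HodgeConjecture.Theorems.F0P6aPELSpreadDefs
import Summits.HodgeConjecture.HodgeConjecture.Theorems.F0P6aStubGSPREAD
import Summits.HodgeConjecture.HodgeConjecture.Theorems.F0P6aStubGEN
import HarnessLib
import HarnessLib.Audit.LibrarySuggestionsDenyListCruxes

/-!
## Import provenance (CANONICAL HEADER — LEAD F0P6-plan (g6) «M-142a» (A): bare `import` lines only; their provenance notes, verbatim)

- `import Summits.HodgeConjecture.HodgeConjecture.Theorems.F0P6aPELSpreadDefs` -- ★ K5-H3 home of THIS hub՚s definitions and sorry-free heads (tree bytes minus the three blocks below; namespace kept): `stageLocLeg`, `IsStageLocalisationAt`, `RecordESpreadCofinal`, `RecordInj0OfStageCofinal`, `RecordPELELawsCofinal`, `stub_INJ0` (PAID), `spread_of_parts`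
- `import Summits.HodgeConjecture.HodgeConjecture.Theorems.F0P6aStubGSPREAD` -- [ED. 4] ★ p853238 twin of the (A2) GSPREAD closer leaf: head `F0P6aStubGSPREAD.gspread_of_line : DualPairOfAmpleRigidified → RecordESpreadCofinal` PAYS `stub_GSPREAD` below BY TERM (LAref-P (g8) #86: junction `J_LofS` TRIO, `payable` TRIO; it imports only ★ `PELSpreadDefs` + Literature ⇒ no cycle, no clash)
- `import Summits.HodgeConjecture.HodgeConjecture.Theorems.F0P6aStubGEN` -- ★ K6 E4 (p853316) twin of the GEN closer leaf: `F0P6aStubGEN.elaws_of_line : RecordPELELawsCofinal` PAYS `stub_ELAWS` below BY TERM (LEAD F0P6-plan «M-145e» (ρ3)); its closure is ★-only (★ `PELSpreadDefs`, ★ E-column), never a `Lines` module — no cycle, no twin clash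
- `import HarnessLib`
- `import HarnessLib.Audit.LibrarySuggestionsDenyListCruxes` -- build-lane export guard (operator companion req547; LEAD «M-119b∕c»: every new `Lines` edition carries it)

# EDITION 4 («DEAD LETTER PAID BY ★ TERM», 2026-09-03; desk F0P6c-plan (g11) cand v2 by copy over ED. 3 65058549bf186101, spec = box LAref-P (g8) #86 (13:19:49Z); written ONLY on a LEAD numbered cue in a declared window,
in ONE request with this hub՚s one `Lines` importer `Lines/F0_P6a_StubGEN.lean` (shim ED. 3a, (ρ2) tie; unchanged bytes) re-made over it): ED. 3 + ONE import (★ `Theorems.F0P6aStubGSPREAD`, p853238) + the socket `stub_GSPREAD`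
PAID BY TERM `:= F0P6aStubGSPREAD.gspread_of_line` (a tree theorem, sorry-free, ★, TRIO; its statement IS `DualPairOfAmpleRigidified → RecordESpreadCofinal` — LAref-P #86 junction `J_LofS` TRIO by kernel) — exactly the
ED. 3 move for `stub_ELAWS` — and the header made CANONICAL («M-142a» (A): the two ED. 3 import notes moved verbatim into «## Import provenance» above).  Live literal `sorry`s: 1 → 0; `spread_of_line`, every FQN,
every statement and every other byte UNCHANGED; `#print axioms stub_GSPREAD` = `#print axioms spread_of_line` = [propext, Classical.choice, Quot.sound] (was `sorryAx`).  This hub is in NO registered cone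
(24832 ← `Lines/d6_cm_curve.lean` {1}; 27458 ∅) and is imported by no `Theorems/` module ⇒ digits ∕ registries UNCHANGED; count-neutral hygiene (tree code-`sorry` inventory −1).  The ED. 3 sentence
«Live literal `sorry`s: 2 → EXACTLY 1 = {`stub_GSPREAD`}» below is SUPERSEDED by this paragraph and kept for the record.
HC_CM is proved only modulo the 7 printed citations (2 remaining named inputs hLiu418 = stmt-HodgeConjecture-24832, h413 = stmt-HodgeConjecture-24833) until rung 0 closes.

# EDITION 3 (K6 «(ρ3) PAY-DOWN», 2026-09-03; LA7-plan (g7) cand, written only on the LEAD՚s numbered cue in the K6 wave that also flips the `Lines/F0_P6a_StubGEN.lean` SHIM):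
ED. 2 f2032b6b8d307192 + ONE import (★ `Theorems.F0P6aStubGEN`) + the socket `stub_ELAWS` PAID BY TERM `:= F0P6aStubGEN.elaws_of_line` (a tree theorem, sorry-free, ★; its statement IS
`RecordPELELawsCofinal` — LEAD «M-145e» (ρ1), LA4-r01 (g5) type tie).  Live literal `sorry`s: 2 → EXACTLY 1 = {`stub_GSPREAD`} (:101 region, OFF-PATH existence core, road (S♭));
`spread_of_line`, every FQN and every other byte UNCHANGED; `#print axioms stub_ELAWS` = [propext, Classical.choice, Quot.sound] expected (was `sorryAx`).  Rev-closure of this hub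
by name (tree `rg`): 4 = {`Lines/F0_P6a_StubGEN` (shim), `F0_P6a_ModuliDatum` (MAIN), `F0_D9opRoad2`, `F0_AlbCm`} — the LEAD «M-145g» digit of record was 5; `Lines/F0_P6a_StubGSPREAD` left this hub՚s importers at its
ED. 2 SHIM (K6 wave 3, 60785899671d63f3: it imports ★ `Theorems.F0P6aStubGSPREAD` → ★ `PELSpreadDefs` only).  The ED. 2 paragraph and the ED. 1 module docstring follow verbatim.

# EDITION 2 (K5-H3 «SHIM + SOCKETS», 2026-09-02; LA7-plan (g7) cand, written only on the LEAD՚s word): this hub now IMPORTS its ★ re-home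
`Theorems/F0P6aPELSpreadDefs.lean` (tree bytes of ED. 1 fbcf7a4ea354fd35 minus the three blocks kept here, namespace KEPT) and keeps, VERBATIM from ED. 1 and in the SAME namespace,
EXACTLY the two registered sockets `stub_GSPREAD` (ED. 1 :253), `stub_ELAWS` (ED. 1 :291) and the junction `spread_of_line := spread_of_parts stub_GSPREAD stub_INJ0 stub_ELAWS`
(ED. 1 :335) — so every FQN (`…F0P6aPELSpread.stub_GSPREAD`, `….stub_ELAWS`, `….spread_of_line`, and through the import `….spread_of_parts`, `….stub_INJ0`, the three
letters), the leaves՚ heads `gspread_of_line`∕`elaws_of_line`, MAIN՚s P-term, and the books՚ socket census of this file (live literal `sorry`s: 2 = {`stub_GSPREAD`, `stub_ELAWS`}, both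
OFF-PATH, closed BY NAME downstream) are UNCHANGED.  The ED. 1 module docstring follows verbatim.

# `F0_P6a_PELSpread` — THE L4 CLOSER LEAF ABOVE THE P-LINE: `spread_of_line : DualPairOfAmpleRigidified → RecordPELSpreadCofinal` (ED. 1 cand v4c, desk F0P6a-plan (g4); LEAD «M-55b» (2)+(4): STAGE CUT for `stub_INJ0` + `UnmixedAt` guards; v4c: `stub_INJ0` PAID IN-LINE by ★ p848591 — live sockets {`stub_GSPREAD`, `stub_ELAWS`})

CRUX `stmt-HodgeConjecture-24832` (HLiu418), sub-line P6a, line «L4».  SOCKET: the P-line `Lines/F0_P6a_PELInputs.lean` ED. 1 `stub_SPREAD`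
(`DualPairOfAmpleRigidified → RecordPELSpreadCofinal`, :664 of v6g 5e0f5e9c).  LEAD «M-55» (c) (2026-09-02T01:55:04Z): a closer LEAF ABOVE the P-line (imports the
served P-line olean), sockets BY NAME, head `spread_of_line` kernel-checked, SAME-STATEMENT tie against `stub_SPREAD`, consumed ONE LEVEL UP at MAIN ED. 8
`stub_RGD := rgd_of_inputs (pel_of_inputs spread_of_line stub_DUALS) datum_of_line`; ROAD (S♭) of record for the existence core («M-55» (b)).
Design memo: `F0/P6/F0P6a-plan/MEMO-PLINE-ED2-stubSPREAD.v1.F0P6a-plan-g4.md` (99417f65) §1–§2; this edition՚s memo v2 = the docstrings below.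

THE CUT (ED. 1 of the leaf, cand v4; JUNK-FREE, THREE sockets, each TRUE as typed; NO stage vocabulary in any statement — every `T` BY VALUE with
its PROVENANCE `T.τE = τE ∧ T.Φ = Φ ∧ HEq T.E E`):
* `stub_GSPREAD : DualPairOfAmpleRigidified → RecordESpreadCofinal` — **THE EXISTENCE CORE, ROAD (S♭)**: EVERY PEL witness `E` over the generic fibre
  `X = (S.M Kc) ⊗_F Fᵢ` of GEN՚s model `𝓜` (by value: ANY `E : PELWitnessE …`, junk included — spreading out is pure [EGA IV₃ 8.10.5] + dual existence)
  SPREADS, off a finite set `S_t(E)` of places, at every split `w ∉ S_t` with `Φ` adapted to `w`, to a localised tuple-with-provenance `T : PELSpreadAt … w …`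
  WHOSE WITNESS IS `E` — and (STAGE CUT, LEAD «M-55b» (2)) it EXPORTS WHAT THE CONSTRUCTOR KNOWS: one stage tuple `(t, 𝒜ₜ, ρₜ, Dₜ, polₜ, lvlₜ)` over
  `𝓜.total ⊗ D(t)` in front of `∃ S_t`, a localisation leg `τ : Spec 𝒪_{F,(w)} → D(t)` per good `w`, and the DEFINITIONAL provenance
  `IsStageLocalisationAt … T.univ T.act T.dual T.pol T.lvl` («`T` IS the stage tuple base-changed along `𝓜.total ◁ τ`», §0).  Payers: B-p18 (g39) ★ (s1♭) p847663 ∕ (s1-A♭) p847675 ∕ (hP-𝓜) (twins of `Limits/LocalizationRelativeProperSpread` +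
  `AbelianSchemes/AbelianSchemeOverSpreadStage` on the PROPER GENERIC FIBRE) and his 8-step chain census `F0/P6/B-p18/g39/CENSUS-stubGSPREAD-chain.v1` c894dffb;
  ★ (GS-2-core) p847586 `PELTupleStageLocalise` + ★ `TupleRelCancel`; ★ BRICK (T); ★ `exists_stage_ringAction` + ★ p847530∕p847650; `dualPairOf stub_DUALS`;
  ★ `exists_stage_polarization_of_generic_polarization_of_isUnit_two''`; ★ `LevelStructureSpreadRelative.exists_stage_of_generic_overStage`; (P-1) ★
  `Polarization.exists_quasiInverse` + «L4» LA4-p01 (Q-SPREAD) + (8) ROSATI∕POLQUASIINV at a stage; the arithmetic rows of `w`.  NO new letter, no Siegel scheme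
  over `ℤ[1∕N]` (road Σ parks, «M-55» (b)).
* `stub_INJ0 : DualPairOfAmpleRigidified → RecordInj0OfStageCofinal` — **(L1′) SPECIAL FINE-MODULI INJECTIVITY OFF A FINITE SET, FOR THE LOCALISATIONS OF ANY
  STAGE TUPLE, GIVEN A SEPARATING WITNESS** (A-p14 (g35) STAGE CUT, memo 9473015d §1; LEAD «M-55b» (2); `E`-free letter): for EVERY stage tuple by value there
  is a finite `S_inj` off which every `T` that IS its localisation (`IsStageLocalisationAt`, exported by `stub_GSPREAD`) and whose witness separates sheet points
  at `w` (`ESepAt S Kc w T.E`, exported by `stub_ELAWS`) satisfies `PELInj0LawAt T`.  TRUE: ★ (GS-3) p847613 per sheet over `Spec 𝓞_{Fᵢ}` + (GS-3a)(GS-3c)(GS-3d)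
  + pieces (b0)–(b4); NO rigidity-transfer organ (R1)–(R4), no `Isom` representability, no normality input.  Payers: A-p14 (GS-3)(GS-3c)(GS-3d), «L4» LA4-p02
  (GS-3a) ★ p847704 ∕ (b1), LA4-p03 (b2′) ★ p847793.
* `stub_ELAWS : RecordPELELawsCofinal` — **GEN՚s CHOICES + THE ADAPTED E-WITNESS FAMILY + ITS E-SIDE LAWS READ ON ANY SPREAD**: GEN՚s block `Fᵢ Kc G φ 𝓜`
  (O1–O4 ★ organs) once; a FINITE family of CM types `Φf i ∋ ι₁` with ONE slice embedding `τE` over `ι₁` and E-witnesses `Ef i : PELWitnessE … (Φf i)`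
  (the E-line head `pelWitnessE_of_line` per `Φ`, compositum of the slice fields, common small level); a finite `S_L`; and at every good split `w ∉ S_L`: the hyperspecial passage `K → Kc`, an index `i` with `Φf i` ADAPTED to `w` (KOTT leaf
  `exists_adapted_frame`), `hdisj` (★ INT-RES), and — for EVERY spread `T` of `Ef i` at `w` — `ESepAt S Kc w T.E` (a cast), `PELHeckeLawAt T` (E-export
  «Hecke-compatibility of `ε`» + transport along `T.gen_iso`) and `PELTwistLawAt T` (E-export «sheet law of `ε`» (Σ-GAL, A-p04) + Shimura–Taniyama at `w`
  for (FROB-𝔞)∕(FROB-n) («L4» LA4-p03 FROB-row arithmetic at the adapted frame) + transport).  TRUE because it speaks of THE witnesses it chooses — a law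
  `∀ T` WITHOUT an E-side hypothesis is FALSE (n5: constant CM families are `PELWitnessE`s), and the E-side hypotheses `EHeckeAt`∕`ETwistAt` (readings of
  `E`՚s tuple at `X`-points, i.e. `RoofΩ`∕`CoverΩ` with base `X` instead of `(𝓜.localise w).total`) are NOT YET TYPED by anyone: the day they are (leaf
  ED. 2), `stub_ELAWS` splits into `stub_GEN` (choices, ★) + `stub_EEXPORT` (E-line: `∃` family with `ESepAt ∧ EHeckeAt ∧ ETwistAt`) + the by-value
  transport stubs `stub_HECKE : ∀ T, EHeckeAt … T.E → PELHeckeLawAt T`, `stub_TWIST : ∀ T, ETwistAt … T.E → PELTwistLawAt T` of LEAD «M-55» (c).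
HEAD `spread_of_parts hG hI hL : DualPairOfAmpleRigidified → RecordPELSpreadCofinal` — SORRY-FREE ZIP (`S_M := S_L ∪ ⋃ i, (S_t i ∪ S_inj i)`, finite
union over the finite index; GEN՚s block PEELED by `Exists.elim`, B-p18 (g38) profile; per `w`: the spread of `hG`, `inj₀` of `hI`, the E-laws of `hL` at
that `T`), and `spread_of_line := spread_of_parts stub_GSPREAD stub_INJ0 stub_ELAWS`; SAME-STATEMENT tie `example : @stub_SPREAD = @spread_of_line := rfl` (elaborates iff the types agree).
Budgets: DEFAULT `maxHeartbeats` everywhere.  No instance, no notation.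
HC_CM is proved only modulo the printed citations (2 remaining named inputs hLiu418 24832, h413 24833) until rung 0 closes — count-neutral.
[cite: RapoportSmithlingZhang2020Diagonal, §4.1 Thm. 4.1 p. 17; Prop. 3.7 pp. 13–14] [cite: Kottwitz1992, §5 pp. 389–391]
[cite: EGAIV3, Thm. 8.10.5 (p. 37); Thm. 8.8.2 (p. 28)] [cite: MumfordFogartyKirwan1994, Ch. 7 §2 Def. 7.2 p. 129; §3 Thm. 7.9 p. 139]
[cite: Shimura1998, §18.6 Thm. 18.6 pp. 124–125] [cite: HarrisTaylorAMS2001, §III.4, pp. 108–110]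
-/

set_option autoImplicit false

noncomputable section

-- Mathlib's `Over`∕pull-back API is stated across semireducible wrappers (as in the ★ `AbelianSchemes/*` stage files).
set_option backward.isDefEq.respectTransparency false

namespace Summit.HodgeConjecture.HodgeConjecture.Cruxes.HLiu418.F0P6aPELSpread

set_option linter.dupNamespace false  -- `Summit.HodgeConjecture.HodgeConjecture.…` BY DESIGN (D-0017)

open CategoryTheory CategoryTheory.Limits NumberField IsDedekindDomain MulAction
open scoped Matrix Polynomial Pointwise
open Literature.NumberTheory.GaloisRepresentations
open Literature.NumberTheory.Automorphic Literature.NumberTheory.Automorphic.UnitaryGroup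
open Literature.AlgebraicGeometry.ShimuraVarieties.UnitaryCanonicalModel
open Literature.NumberTheory.Automorphic.Liu2021.AppendixC
open Literature.AlgebraicGeometry.Motives (AlgPoints IntegralModel SchemeOver thickening thickeningGalAction thickeningLift)
open Literature.NumberTheory.DiophantineGeometry (geomResidueField specialFibreFunctor)
open Literature.AlgebraicGeometry.RelativeSpec (ActionOver)
open Literature.NumberTheory.EllipticCurves (genericFibre)
open AlgebraicGeometry (QuasiCompact QuasiSeparated LocallyOfFinitePresentation Flat IsSeparated)
open Summit.HodgeConjecture.HodgeConjecture.Cruxes.HLiu418.F0P6aModuliDatumDefs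
open Summit.HodgeConjecture.HodgeConjecture.Cruxes.HLiu418.F0P6aRGDAssembly
open Summit.HodgeConjecture.HodgeConjecture.Cruxes.HLiu418.F0P6aPELWitnessE (PELWitnessE IsCMTypeThrough)
open Summit.HodgeConjecture.HodgeConjecture.Cruxes.HLiu418.F0P6aStubKOTT (KottAdaptedAt UnmixedAt)
open Summit.HodgeConjecture.HodgeConjecture.Cruxes.HLiu418.F0P6aPELInputs
open Literature.AlgebraicGeometry.Motives (specOver)
open Literature.AlgebraicGeometry.Limits.LocApprox (Idx baseDiagram)
open MonoidalCategory

/-! ### §2 The registered stubs (letters BY VALUE; `stub_GSPREAD` PAID BY TERM since ED. 4; `stub_ELAWS` PAID BY TERM since ED. 3; `stub_INJ0` PAID IN-LINE since cand v4c, ★ since K5-H3) -/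

/-- **PAID BY TERM at ED. 4** (tree theorem ★ `F0P6aStubGSPREAD.gspread_of_line`, p853238 — the (A2) GSPREAD closer leaf re-homed; sorry-free, TRIO; statement UNCHANGED: LAref-P (g8) #86 `J_LofS` TRIO).
**`stub_GSPREAD` — THE EXISTENCE CORE OF THE SPREAD, ROAD (S♭)** (LEAD «M-55» (b); LOAD-BEARING, size L–XL, ★ parents all landed or report-first GREEN):
from the DUALS socket `DualPairOfAmpleRigidified` (the road-(A) letter replacing P-2′ `dualAbelianSchemeExists` from v6g on, LEAD «M-55c»), every PEL witness over the proper generic fibre spreads to cofinitely many split places with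
its provenance (`RecordESpreadCofinal`).  Why it might fail: only a currency mismatch between the ★ stage organs and the `PELSpreadAt` rows (checked by import);
the mathematics is [EGA IV₃] 8.10.5 + [MumfordAV1970] §7 + [RapoportSmithlingZhang2020Diagonal] Thm. 4.1.  Payers: B-p18 (g39) ★ (s1♭)(s1-A♭)(hP-𝓜), ★ (GS-2-core),
★ BRICK (T), «L4» LA4-p01 (integration).
[cite: EGAIV3, Thm. 8.10.5 (p. 37)] [cite: MumfordAV1970, §7 Thm. 4 (p. 72)] [cite: RapoportSmithlingZhang2020Diagonal, §4.1 Thm. 4.1 p. 17] -/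
theorem stub_GSPREAD : DualPairOfAmpleRigidified → RecordESpreadCofinal :=
  Summit.HodgeConjecture.HodgeConjecture.Cruxes.HLiu418.F0P6aStubGSPREAD.gspread_of_line

/-- **PAID BY TERM at ED. 3** (tree theorem ★ `F0P6aStubGEN.elaws_of_line` = `elaws_of_parts stub_GEN heckeZip_holds twistZip_holds`, GEN zip over the ★ X-leaf head `F0P6aEExports.eLaws_of_frames`; gate `dedup` n∕a — hub-side `Lines` file; statement UNCHANGED).
**`stub_ELAWS` — GEN՚s CHOICES, THE ADAPTED E-WITNESS FAMILY AND ITS E-SIDE LAWS ON ANY SPREAD** (`RecordPELELawsCofinal`; LOAD-BEARING, size XL; the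
E-LINE CONTENT of the old `stub_SPREAD`): door (E)՚s moduli property (`ESepAt`, at every place), the Hecke roofs (`PELHeckeLawAt`, E-export + transport) and the
Serre covers with twist data and Frobenius readings (`PELTwistLawAt`, E-export sheet law + Shimura–Taniyama + transport), for the witnesses it chooses.  Why it
might fail: the E-side laws are NOT YET exported by the E-line in E-currency (its head delivers `Nonempty (PELWitnessE …)` by value) and the E-currency
readings `EHeckeAt`∕`ETwistAt` are untyped — until they are, this stub cannot be split into the by-value transport stubs `stub_HECKE`∕`stub_TWIST` + `stub_GEN`
+ `stub_EEXPORT` and is paid only as a whole (leaf ED. 2 re-earns the split); a law `∀ T` without the E-side hypothesis would be FALSE (n5).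
[cite: RapoportSmithlingZhang2020Diagonal, §4.1 Thm. 4.1 p. 17] [cite: Shimura1998, §18.6 Thm. 18.6 pp. 124–125; §13.1 Thm. 1 pp. 97–99] [cite: HarrisTaylorAMS2001, §III.4, pp. 108–110]
[cite: Kottwitz1992, §5 pp. 389–391] [cite: Deligne1971TravauxShimura, 4.16 p. 150] -/
theorem stub_ELAWS : RecordPELELawsCofinal :=
  Summit.HodgeConjecture.HodgeConjecture.Cruxes.HLiu418.F0P6aStubGEN.elaws_of_line

/-- **HEAD `spread_of_line : DualPairOfAmpleRigidified → RecordPELSpreadCofinal`** (modulo `stub_GSPREAD stub_INJ0 stub_ELAWS`) — `spread_of_parts` AT THE THREE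
REGISTERED STUBS; the future BODY of the P-line՚s `stub_SPREAD` (MAIN ED. 8: `stub_RGD := rgd_of_inputs (pel_of_inputs spread_of_line stub_DUALS) datum_of_line`, «M-55» (c)).
Sorry-free given the stubs. [cite: RapoportSmithlingZhang2020Diagonal, §4.1 Thm. 4.1 p. 17] -/
theorem spread_of_line : DualPairOfAmpleRigidified → RecordPELSpreadCofinal :=
  spread_of_parts stub_GSPREAD stub_INJ0 stub_ELAWS

end Summit.HodgeConjecture.HodgeConjecture.Cruxes.HLiu418.F0P6aPELSpread

end
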